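import Summits.CriticalPhenomena.PercolationContinuityZ3.Theorems.PercNearOneGluingNoHeavyLowerTailCSHLevelForms
import HarnessLib

/-!
# `NoHeavyLowerTail` (stmt-CriticalPhenomena-4575) — MIXED conditioned slack hierarchy (hub observer): the pointwise unfolding identity
# of Lemma U with a HUB ROW (the KEY SET IDENTITY of the mixed Lemma U, level-form algebra only)

Support file (`--supports stmt-CriticalPhenomena-4575`), prover `prim-hp-7` (gen 33); part (a) of brick B2 (`MixCSHUnfold`) of prim-ineq-gen-7's Lean
blueprint for THEOREM M1 (memo `prim-ineq-gen-7/PROOF-Q9-MIXED-CSH.md` §3.2 / §10, write-up `Q9-WRITEUP.md` Lemma 6.3 Step 1).  Pure algebra over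
the level forms `CSH.slForm` (prim-hp-8) and the abstract indicators `CSH.chi / jn / av / unfoldT / unfoldK` of prim-ineq-prove-1's
`…CSHLevelForms.lean`; no measure theory, no named facts, no sorries.

SETTING.  An abstract symmetric transitive relation `R` on `V` (open reachability in a world configuration), a HUB LABEL `o : V` (never a
decoy), and an abstract HUB PREDICATE `Hc : V → Prop` ("the hub is joined to `u`"; in the application `Hc u ⟺ 1{Σ ↮ Y}(ω) ∧ ∃ σ ∈ Σ, σ R u`)
which is CLOSED under `R` (`Hc a → R a b → Hc b`).  The mixed row functions carry the hub quantity at the label `o` and the pure one elsewhere: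
* `MixCSH.mixJn R Hc o S u`  = `1{∃ s ∈ S, Hc s}` at `u = o` (the hub is joined to the set `S`), `CSH.jn R S u` otherwise;
* `MixCSH.mixChi R Hc o S d u` = `1{Hc d ∧ ∀ s ∈ S, ¬ Hc s}` at `u = o` (the hub is joined to the decoy `d` AND NOT to `S` — the extra factor
  of the memo's KEY SET IDENTITY `{Σ ↔ S ∪ d} = {Σ ↔ S} ⊔ ({d ↮ S} ∩ {Σ ↔ d} ∩ {Σ ↮ S})`, i.e. the mixed test of the lower-level system
  with owner `d` and avoided set `S`), `CSH.chi R u d` otherwise;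
* `MixCSH.mixUnfoldT R Hc o S L u` = the recursion of `CSH.unfoldT` with `mixChi` in place of `chi`.
RESULTS: the one-step identity `slStep (d,c) (mixJn S) = mixJn (S ∪ {d}) − c − ε_S(d)·(mixChi S d − c)` (`slStep_mixJn`, `d ≠ o`), THE POINTWISE
CLAIM WITH A HUB ROW `sl_L[mixJn S](u) = mixJn (S ∪ decoys L)(u) − mixUnfoldT_S(L)(u) + unfoldK(L)(u)` (`slForm_mixJn`, decoys `≠ o`; the
configuration-free remainder `CSH.unfoldK` is the SAME as in the pure case), and `mixUnfoldT = unfoldT` off the hub label (`mixUnfoldT_of_ne`: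
the rows of genuine vertices unfold exactly as before).
[cite: KozmaNitzan2024, Question 9 (§5.5 p. 36), Conj. 4 (p. 32)] [cite: VandenbergHaggstromKahn2005, Thm. 1.3 (p. 6)]
-/

noncomputable section

namespace Summit.CriticalPhenomena.PercolationContinuityZ3.Theorems

open scoped Classical
open CSH

namespace MixCSH

variable {V : Type*}

section Unfold

variable (R : V → V → Prop) (Hc : V → Prop) (o : V)

/-- `1{the hub is joined to the set S}` = `1{∃ s ∈ S, Hc s}`.
(transcription of the cell memo prim-ineq-gen-7 PROOF-Q9-MIXED-CSH.md §3.2, the hub row `J^i_o`) [folklore] -/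
def hubJn (S : Set V) : ℝ := if ∃ s ∈ S, Hc s then 1 else 0

/-- `1{the hub is joined to d and not to S}` — the hub entry of the mixed decoy test (KEY SET IDENTITY of the memo).
(transcription of the cell memo prim-ineq-gen-7 PROOF-Q9-MIXED-CSH.md §3.2, `ω^{(i)}_o`) [folklore] -/
def hubChi (S : Set V) (d : V) : ℝ := if (Hc d ∧ ∀ s ∈ S, ¬ Hc s) then 1 else 0

/-- The mixed row function `u ↦ 1{u ↔ S}` with the hub value at the label `o`.
(transcription of the cell memo prim-ineq-gen-7 PROOF-Q9-MIXED-CSH.md §3.2) [folklore] -/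
def mixJn (S : Set V) : V → ℝ := fun u => if u = o then hubJn Hc S else jn R S u

/-- The mixed decoy test `u ↦ 1{u ↔ d}` with the hub value `1{hub ↔ d, hub ↮ S}` at the label `o`.
(transcription of the cell memo prim-ineq-gen-7 PROOF-Q9-MIXED-CSH.md §3.2) [folklore] -/
def mixChi (S : Set V) (d : V) : V → ℝ := fun u => if u = o then hubChi Hc S d else chi R u d

/-- The unfolded decoy terms with a hub row: `mixUnfoldT_S([]) = 0`,
`mixUnfoldT_S((d,c)::L') = ε_S(d)·sl_{L'}[mixChi_S d − c] + mixUnfoldT_{S∪{d}}(L')`.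
(transcription of the cell memo prim-ineq-gen-7 PROOF-Q9-MIXED-CSH.md §3.2, `Σ_j 1{E_j} M^{(j,k)}` with the hub row) [folklore] -/
def mixUnfoldT : Set V → List (V × (V → ℝ)) → V → ℝ
  | _, [] => fun _ => 0
  | S, (d, c) :: L' => fun u => av R S d * slForm L' (fun w => mixChi R Hc o S d w - c w) u + mixUnfoldT (insert d S) L' u

/-- Unfolding of `mixUnfoldT` at the empty list. [folklore] -/
@[simp] theorem mixUnfoldT_nil (S : Set V) (u : V) : mixUnfoldT R Hc o S [] u = 0 := rfl

/-- Unfolding of `mixUnfoldT` at a cons. [folklore] -/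
theorem mixUnfoldT_cons (S : Set V) (d : V) (c : V → ℝ) (L' : List (V × (V → ℝ))) (u : V) :
    mixUnfoldT R Hc o S ((d, c) :: L') u =
      av R S d * slForm L' (fun w => mixChi R Hc o S d w - c w) u + mixUnfoldT R Hc o (insert d S) L' u := rfl

/-- Off the hub label the mixed row function is the pure one. [folklore] -/
theorem mixJn_of_ne (S : Set V) {u : V} (hu : u ≠ o) : mixJn R Hc o S u = jn R S u := by
  simp [mixJn, hu]

/-- At the hub label the mixed row function is the hub indicator. [folklore] -/
theorem mixJn_hub (S : Set V) : mixJn R Hc o S o = hubJn Hc S := by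
  simp [mixJn]

/-- Off the hub label the mixed decoy test is the pure one. [folklore] -/
theorem mixChi_of_ne (S : Set V) (d : V) {u : V} (hu : u ≠ o) : mixChi R Hc o S d u = chi R u d := by
  simp [mixChi, hu]

/-- At the hub label the mixed decoy test is `1{hub ↔ d, hub ↮ S}`. [folklore] -/
theorem mixChi_hub (S : Set V) (d : V) : mixChi R Hc o S d o = hubChi Hc S d := by
  simp [mixChi]

/-- **THE KEY SET IDENTITY at the hub** (memo §3.2): `1{hub ↔ S ∪ {d}} = 1{hub ↔ S} + 1{hub ↔ d, hub ↮ S}·1{d ↮ S}`, for a hub predicate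
closed under the (symmetric) relation `R`: if the hub is joined to `d` and `d R s` then the hub is joined to `s`.
(transcription of the cell memo prim-ineq-gen-7 PROOF-Q9-MIXED-CSH.md §3.2, KEY SET IDENTITY) [folklore] -/
theorem hubJn_insert (hH : ∀ a b, Hc a → R a b → Hc b) (S : Set V) (d : V) :
    hubJn Hc (insert d S) = hubJn Hc S + hubChi Hc S d * av R S d := by
  unfold hubJn hubChi av
  by_cases h1 : ∃ s ∈ S, Hc s
  · obtain ⟨s, hs, hcs⟩ := h1
    rw [if_pos ⟨s, Set.mem_insert_of_mem _ hs, hcs⟩, if_pos ⟨s, hs, hcs⟩, if_neg (fun h => h.2 s hs hcs)]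
    ring
  · rw [if_neg h1]
    by_cases h2 : Hc d
    · rw [if_pos ⟨d, Set.mem_insert _ _, h2⟩, if_pos ⟨h2, fun s hs hcs => h1 ⟨s, hs, hcs⟩⟩,
        if_pos (fun s hs hds => h1 ⟨s, hs, hH d s h2 hds⟩)]
      ring
    · have h3 : ¬ (Hc d ∧ ∀ s ∈ S, ¬ Hc s) := fun h => h2 h.1
      have h4 : ¬ ∃ s ∈ insert d S, Hc s := by
        rintro ⟨s, hs, hcs⟩
        rcases Set.mem_insert_iff.1 hs with rfl | hs
        · exact h2 hcs
        · exact h1 ⟨s, hs, hcs⟩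
      rw [if_neg h3, if_neg h4]
      ring

/-- The mixed split `mixJn (S ∪ {d}) u = mixJn S u + mixChi S d u · ε_S(d)` (the pure `CSH.jn_insert` off the hub, the KEY SET IDENTITY at
the hub). [folklore] -/
theorem mixJn_insert (hRs : ∀ a b, R a b → R b a) (hRt : ∀ a b c, R a b → R b c → R a c)
    (hH : ∀ a b, Hc a → R a b → Hc b) (S : Set V) (d u : V) :
    mixJn R Hc o (insert d S) u = mixJn R Hc o S u + mixChi R Hc o S d u * av R S d := by
  by_cases hu : u = o
  · subst hu
    rw [mixJn_hub, mixJn_hub, mixChi_hub, hubJn_insert R Hc hH S d]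
  · rw [mixJn_of_ne R Hc o _ hu, mixJn_of_ne R Hc o _ hu, mixChi_of_ne R Hc o _ _ hu, jn_insert R hRs hRt S d u]

/-- At a decoy `d ≠ o`: `mixJn S d = 1 − ε_S(d)`. [folklore] -/
theorem mixJn_decoy (S : Set V) {d : V} (hd : d ≠ o) : mixJn R Hc o S d = 1 - av R S d := by
  rw [mixJn_of_ne R Hc o S hd, jn_eq_one_sub_av]

/-- **One level step on the mixed row function** (`d ≠ o`):
`slStep (d,c) (mixJn S) = mixJn (S ∪ {d}) − c − ε_S(d)·(mixChi S d − c)`.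
(transcription of the cell memo prim-ineq-gen-7 PROOF-Q9-MIXED-CSH.md §3.2, "the CLAIM of [W] 5.3 holds verbatim with the hub test") [folklore] -/
theorem slStep_mixJn (hRs : ∀ a b, R a b → R b a) (hRt : ∀ a b c, R a b → R b c → R a c)
    (hH : ∀ a b, Hc a → R a b → Hc b) (S : Set V) {d : V} (hd : d ≠ o) (c : V → ℝ) :
    slStep (d, c) (mixJn R Hc o S) = mixJn R Hc o (insert d S) - c - av R S d • (fun w => mixChi R Hc o S d w - c w) := by
  funext u
  simp only [slStep, Pi.sub_apply, Pi.smul_apply, smul_eq_mul]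
  rw [mixJn_insert R Hc o hRs hRt hH S d u, mixJn_decoy R Hc o S hd]
  ring

/-- **THE POINTWISE CLAIM OF THE MIXED LEMMA U** (memo §3.2 Step 1): for a symmetric transitive `R`, a hub predicate closed under `R`, and a
decoy list avoiding the hub label, `sl_L[mixJn S](u) = mixJn (S ∪ decoys(L))(u) − mixUnfoldT_S(L)(u) + unfoldK(L)(u)` with the SAME
configuration-free remainder `CSH.unfoldK` as in the pure CLAIM `CSH.slForm_jn`.
(transcription of the cell memo prim-ineq-gen-7 PROOF-Q9-MIXED-CSH.md §3.2 Step 1) [folklore] -/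
theorem slForm_mixJn (hRs : ∀ a b, R a b → R b a) (hRt : ∀ a b c, R a b → R b c → R a c)
    (hH : ∀ a b, Hc a → R a b → Hc b) (L : List (V × (V → ℝ))) (hL : ∀ dc ∈ L, dc.1 ≠ o) (S : Set V) (u : V) :
    slForm L (mixJn R Hc o S) u = mixJn R Hc o (S ∪ {d | d ∈ L.map Prod.fst}) u - mixUnfoldT R Hc o S L u + unfoldK L u := by
  induction L generalizing S u with
  | nil => simp [unfoldK]
  | cons dc L ih =>
      obtain ⟨d, c⟩ := dc
      have hd : d ≠ o := hL (d, c) List.mem_cons_self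
      have hL' : ∀ dc ∈ L, dc.1 ≠ o := fun dc hdc => hL dc (List.mem_cons_of_mem _ hdc)
      rw [slForm_cons_eq, slStep_mixJn R Hc o hRs hRt hH S hd c, slForm_sub, slForm_sub, slForm_smul]
      simp only [Pi.sub_apply, Pi.smul_apply, smul_eq_mul, ih hL' (insert d S) u, mixUnfoldT_cons, unfoldK]
      have hset : insert d S ∪ {d' | d' ∈ L.map Prod.fst} = S ∪ {d' | d' ∈ ((d, c) :: L).map Prod.fst} := by
        ext a
        simp only [Set.mem_union, Set.mem_insert_iff, Set.mem_setOf_eq, List.map_cons, List.mem_cons]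
        tauto
      rw [hset]
      ring

/-- **The rows of genuine vertices unfold as in the pure hierarchy**: off the hub label, `mixUnfoldT_S(L)(u) = unfoldT_S(L)(u)` (the level form
`sl_{L'}` only reads its argument at `u` and at the decoys, none of which is the hub label). [folklore] -/
theorem mixUnfoldT_of_ne (L : List (V × (V → ℝ))) (hL : ∀ dc ∈ L, dc.1 ≠ o) (S : Set V) {u : V} (hu : u ≠ o) :
    mixUnfoldT R Hc o S L u = unfoldT R S L u := by
  induction L generalizing S with
  | nil => rfl
  | cons dc L ih =>
      obtain ⟨d, c⟩ := dc
      have hL' : ∀ dc ∈ L, dc.1 ≠ o := fun dc hdc => hL dc (List.mem_cons_of_mem _ hdc)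
      simp only [mixUnfoldT_cons, unfoldT, ih hL' (insert d S)]
      congr 2
      exact slForm_congr L (by rw [mixChi_of_ne R Hc o S d hu]) fun dc hdc => by rw [mixChi_of_ne R Hc o S d (hL' dc hdc)]

/-- At the owner's singleton source set the mixed row function is the mixed observation test:
`mixJn {x} u = 1{x ↔ u}` off the hub and `1{Hc x}` at the hub. [folklore] -/
theorem mixJn_singleton (x u : V) :
    mixJn R Hc o {x} u = if u = o then (if Hc x then (1 : ℝ) else 0) else chi R u x := by
  by_cases hu : u = o
  · subst hu
    rw [mixJn_hub, if_pos rfl]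
    unfold hubJn
    simp only [Set.mem_singleton_iff, exists_eq_left]
  · rw [mixJn_of_ne R Hc o _ hu, if_neg hu, jn_singleton]

end Unfold

end MixCSH

end Summit.CriticalPhenomena.PercolationContinuityZ3.Theorems

end
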